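import Summits.CriticalPhenomena.PercolationContinuityZ3.Theorems.Transplant.FKConnectivityAllQPat3Defs
import Summits.CriticalPhenomena.PercolationContinuityZ3.Theorems.Transplant.FKConnectivityAllQAntipodalWeightUpc
import HarnessLib

/-!
# Connectivity correlation inequalities for `φ_{w,q}`, every `q > 0` — THEOREM U IN TABLE FORM: the RECTANGLE generators
# `(1{x~y in pat γ} − 1{x~y in pat γᶜ}) · 1{pat γ ∈ U} · 1{pat γᶜ ∈ D} ≥ 0` levelwise on two-terminal series–parallel networks

Definitions + theorems file (`--supports stmt-CriticalPhenomena-4575`), census lane `prim-bschramm-census` (gen 36) of the post-continuity programme (LANE 2 bschramm, FK sub-lane);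
builds on p205010 (kernel theorem, internal audit signed; external expert review pending).
No named facts, no sorries; standard axioms.  The third kind of generator of census g34's product-cone certificates
(PROOF-THEOREM-SP §2.4: "13 valid one-level functionals on TTSP 3-mark pieces", `u_members(3,2,2)`), in the table vocabulary of
`…Pat3Defs.lean`, as a COROLLARY of fk-2's kernel Theorem U with level weights (`FK.apUpcLW_nonneg_of_isTTSP`,
`…AntipodalWeightUpc.lean`): `FK.Pat3.ble` (refinement order), `FK.Pat3.isUpper` / `FK.Pat3.isLower` (executable up-/

noncomputable section

namespace Summit.CriticalPhenomena.PercolationContinuityZ3.Theorems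

namespace FK

open SimpleGraph Literature.Probability.LatticeModels Literature.Probability.Percolation

/-! ### The refinement order on patterns and monotonicity of `pat3` -/

/-- **Refinement order on patterns** (as a `Bool`): `P ≼ Q` iff every pair joined in `P` is joined in `Q` (`sep` is the bottom,
`all` the top, the three two-block patterns are pairwise incomparable). [folklore] -/
def Pat3.ble (P Q : Pat3) : Bool := (!P.xy || Q.xy) && (!P.xs || Q.xs) && (!P.ys || Q.ys)

/-- An UP-SET of patterns (closed under coarsening), as an executable check. [folklore] -/
def Pat3.isUpper (U : Pat3 → Bool) : Bool :=
  decide (∀ P Q : Pat3, U P = true → Pat3.ble P Q = true → U Q = true)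

/-- A DOWN-SET of patterns (closed under refining), as an executable check. [folklore] -/
def Pat3.isLower (D : Pat3 → Bool) : Bool :=
  decide (∀ P Q : Pat3, D Q = true → Pat3.ble P Q = true → D P = true)

/-- What `Pat3.isUpper` says. [folklore] -/
theorem Pat3.isUpper_spec {U : Pat3 → Bool} (h : Pat3.isUpper U = true) {P Q : Pat3} (hP : U P = true)
    (hPQ : Pat3.ble P Q = true) : U Q = true :=
  of_decide_eq_true h P Q hP hPQ

/-- What `Pat3.isLower` says. [folklore] -/
theorem Pat3.isLower_spec {D : Pat3 → Bool} (h : Pat3.isLower D = true) {P Q : Pat3} (hQ : D Q = true)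
    (hPQ : Pat3.ble P Q = true) : D P = true :=
  of_decide_eq_true h P Q hQ hPQ

open scoped Classical

variable {V : Type*}

/-- **`pat3` is monotone**: adding edges coarsens the pattern. [folklore] -/
theorem pat3_mono {γ γ' : Finset (Sym2 V)} (h : γ ⊆ γ') (x y s : V) : Pat3.ble (pat3 γ x y s) (pat3 γ' x y s) = true := by
  have hle : openGraph (↑γ : BondConfig V) ≤ openGraph (↑γ' : BondConfig V) := by
    intro a b hab
    rw [openGraph_adj] at hab ⊢
    exact ⟨h hab.1, hab.2⟩
  have i1 : (pat3 γ x y s).xy = true → (pat3 γ' x y s).xy = true := fun h1 =>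
    (pat3_xy_iff γ' x y s).2 (((pat3_xy_iff γ x y s).1 h1).mono hle)
  have i2 : (pat3 γ x y s).xs = true → (pat3 γ' x y s).xs = true := fun h1 =>
    (pat3_xs_iff γ' x y s).2 (((pat3_xs_iff γ x y s).1 h1).mono hle)
  have i3 : (pat3 γ x y s).ys = true → (pat3 γ' x y s).ys = true := fun h1 =>
    (pat3_ys_iff γ' x y s).2 (((pat3_ys_iff γ x y s).1 h1).mono hle)
  unfold Pat3.ble
  cases h1 : (pat3 γ x y s).xy <;> cases h2 : (pat3 γ x y s).xs <;> cases h3 : (pat3 γ x y s).ys <;>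
    cases h1' : (pat3 γ' x y s).xy <;> cases h2' : (pat3 γ' x y s).xs <;> cases h3' : (pat3 γ' x y s).ys <;>
    simp_all

/-! ### Theorem-U rectangles as tables -/

/-- **Theorem-U rectangle table** for an up-set `U` and a down-set `D` of patterns (census g34 PROOF-THEOREM-SP §2.4, fk-2's
Theorem U with the increasing test function `h(γ) = 1{pat γ ∈ U} · 1{pat γᶜ ∈ D}`):
`uRectTab U D (P, Q) = (1{x~y in P} − 1{x~y in Q}) · 1{P ∈ U} · 1{Q ∈ D}`. [cite: Grimmett2006, §3.8 Thm. (3.90) (pp. 61–62)] -/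
def uRectTab (U D : Pat3 → Bool) : Pat3 → Pat3 → ℤ :=
  fun P Q => ((if P.xy then 1 else 0) - (if Q.xy then 1 else 0)) * (if U P && D Q then 1 else 0)

/-- **THEOREM U IN TABLE FORM (the rectangle generators of census g34 §2.4; kernel via fk-2's `FK.apUpcLW_nonneg_of_isTTSP`).**
For a two-terminal series–parallel network `E` between `x` and `y`, ANY third vertex `s`, an up-set `U` and a down-set `D` of
patterns, and every nonnegative weight sequence: `0 ≤ tval w E x y s (uRectTab U D)`, i.e. at every level
`∑_{(P,Q) ∈ U × D} (1{x~y in P} − 1{x~y in Q}) · N_E[ν; P, Q] ≥ 0` — e.g. `n{⊤;⊥} ≥ n{xy|s;xs|y} + n{xy|s;x|ys}`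
(`U = {all}ᶜ…`; census g34 lists 13 such rectangles for three marks). [cite: Grimmett2006, §3.8 Thm. (3.90) (pp. 61–62)]
[cite: AyyerLinussonRavichandran2025, §7 (p. 22)] -/
theorem uRect_nonneg [Fintype V] {E : Finset (Sym2 V)} {x y : V} (hE : IsTTSP E x y) (s : V) {U D : Pat3 → Bool}
    (hU : Pat3.isUpper U = true) (hD : Pat3.isLower D = true) {w : ℕ → ℝ} (hw : ∀ n, 0 ≤ w n) :
    0 ≤ tval w E x y s (uRectTab U D) := by
  set h : Finset (Sym2 V) → ℝ := fun γ => if U (pat3 γ x y s) && D (pat3 (E \ γ) x y s) then 1 else 0 with hh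
  have hmono : ∀ ⦃A B : Finset (Sym2 V)⦄, A ⊆ B → B ⊆ E → h A ≤ h B := by
    intro A B hAB hBE
    simp only [hh]
    by_cases hA : (U (pat3 A x y s) && D (pat3 (E \ A) x y s)) = true
    · have hA' := Bool.and_eq_true_iff.1 hA
      have hB1 : U (pat3 B x y s) = true := Pat3.isUpper_spec hU hA'.1 (pat3_mono hAB x y s)
      have hB2 : D (pat3 (E \ B) x y s) = true :=
        Pat3.isLower_spec hD hA'.2 (pat3_mono (Finset.sdiff_subset_sdiff le_rfl hAB) x y s)
      rw [if_pos hA, if_pos (Bool.and_eq_true_iff.2 ⟨hB1, hB2⟩)]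
    · rw [if_neg hA]
      split_ifs <;> norm_num
  have key := apUpcLW_nonneg_of_isTTSP hE E le_rfl w hw h hmono
  unfold apUpcLW at key
  unfold tval
  refine key.trans_eq (Finset.sum_congr rfl fun γ _ => ?_)
  congr 1
  have e1 : apConn γ x y = ((if (pat3 γ x y s).xy then 1 else 0 : ℤ) : ℝ) := by
    unfold apConn
    by_cases hr : (openGraph (↑γ : BondConfig V)).Reachable x y
    · rw [if_pos hr, pat3_xy, conn_of_reachable hr]; simp
    · rw [if_neg hr, pat3_xy, conn_of_not_reachable hr]; simp
  have e2 : apConn (E \ γ) x y = ((if (pat3 (E \ γ) x y s).xy then 1 else 0 : ℤ) : ℝ) := by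
    unfold apConn
    by_cases hr : (openGraph (↑(E \ γ) : BondConfig V)).Reachable x y
    · rw [if_pos hr, pat3_xy, conn_of_reachable hr]; simp
    · rw [if_neg hr, pat3_xy, conn_of_not_reachable hr]; simp
  simp only [hh, uRectTab, e1, e2]
  push_cast
  split_ifs <;> simp

/-- **Example rectangle**: `U = {xy|s, all}ᶜᶜ …` — concretely the rectangle `U := (·.xy)` (patterns joining `x ~ y`: `{all, xy|s}`),
`D := fun Q => !Q.xy` (patterns separating `x, y`): `n{xy|s;xs|y} + n{xy|s;x|ys} + n{xy|s;⊥} + n{⊤;xs|y} + n{⊤;x|ys} + n{⊤;⊥} ≥ 0` is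
trivial, but with `U := fun _ => true`, `D := fun _ => true` the table is Theorem U for `h ≡ 1`:
`N[⊤ or xy|s ; ·] ≥ N[· ; ⊤ or xy|s]`-type balance; the thirteen census rectangles are the instances with `U`, `D` generated by
single patterns.  Here: the up-set / down-set checks for the two trivial choices, by `decide`. [folklore] -/
theorem uRect_trivial_checks : Pat3.isUpper (fun _ => true) = true ∧ Pat3.isLower (fun _ => true) = true ∧
    Pat3.isUpper (fun P => P.xy) = true ∧ Pat3.isLower (fun Q => !Q.xy) = true := by
  refine ⟨by decide, by decide, by decide, by decide⟩

end FK

end Summit.CriticalPhenomena.PercolationContinuityZ3.Theorems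

end
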